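import Literature.MathematicalPhysics.QuantumLattice.TwistedBoundaryConditionsProofs
import Literature.MathematicalPhysics.QuantumLattice.TwistEaterExistenceProofs
import Literature.MathematicalPhysics.QuantumFieldTheory.QCDTwistedSlab
import Mathlib.LinearAlgebra.Eigenspace.Triangularizable
import Mathlib.LinearAlgebra.Matrix.NonsingularInverse
import HarnessLib

/-!
# Irreducibility of twist eaters with a primitive commutation phase; the `SU(N)` clock–shift twist
# is isolating (unique pair modulo conjugation, finite centraliser)

Topic `Literature/MathematicalPhysics/QuantumLattice`; sibling of `TwistedBoundaryConditions.lean` (twists,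
`IsTwistEater`, `IsIrreducibleFamily`, the named fact `TwistEaterUniqueness`), `TwistedBoundaryConditionsProofs.lean`
(`TwistEaterUniqueness_holds`: uniqueness of twist eaters GIVEN irreducibility of each solution) and
`TwistEaterExistenceProofs.lean` (`EaterIffOrthogonal_holds`: existence iff `κ(n) = 0`, `d = 4`; its docstring records
«nothing on uniqueness/irreducibility of the eaters (op. cit. §4.2 second and third bullet)»); the centre-phase group
law (`centerPhase_add`, `suCenter_zero/add/neg`) is reused from `QuantumFieldTheory/QCDTwistedSlab.lean`.  This file proves
those bullets in the case that drives every twisted-box construction — a plane whose twist GENERATES the centre: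

* ★ `exists_eq_smul_one_of_commute_pair` (Weyl–Schwinger–'t Hooft pair, [cite: Gonzalezarroyo1998, §4.2];
  [cite: Schwinger1960, §1]): if `A`, `B` are invertible `N × N` complex matrices with `A B = ω · B A` for a PRIMITIVE
  `N`-th root of unity `ω`, every matrix commuting with `A` and `B` is a scalar — «in 2 dimensions … the representation
  is irreducible if `p₁ = N` (⇔ `q = 1`)» (González-Arroyo 1998 §4.2).  Proof (the printed «maximal abelian subgroup»
  construction, op. cit. p. 6): an eigenvector `v` of `A` (`ℂ` algebraically closed) generates the chain `Bᵏv`,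
  `k < N`, of eigenvectors of `A` with the pairwise distinct eigenvalues `ωᵏλ`, hence a basis; a matrix `M` commuting
  with `A` maps `v` into the (one-dimensional) `λ`-eigenspace, `Mv = c v`, and commuting with `B` gives `M = c·1` on
  the whole chain;
* `isIrreducibleFamily_of_pair`, ★ `isIrreducibleFamily_of_isTwistEater`: a family containing such a pair — in
  particular every twist eater of a twist `z` one of whose planes carries `ω^k · 1` with `k` a unit of `ℤ/N` — is
  irreducible; hence ★ `twistEater_unique_of_isUnit` = `TwistEaterUniqueness` WITHOUT irreducibility hypotheses and
  `twistEater_finite_classes_of_isUnit` (the classical vacua of such a twisted theory modulo gauge form a finite set);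
* the `SU(N)` pair level (`d = 2`, op. cit. p. 6: «the solution … `Γ₀ = Q_N^{n₀₁}`, `Γ₁ = P_N⁺`, which is unique modulo
  similarity transformations (if `N` and `n₀₁` are coprime)»): `exists_pair_commutator_eq_suCenter` (a pair with
  commutator `ω^k · 1` exists for EVERY `k`, from `EaterIffOrthogonal_holds` with `n₀₁ = k`, all other `n_{μν} = 0`),
  ★ `pair_conj_of_commutator_eq_suCenter` (for a unit `k` any two such pairs are SIMULTANEOUSLY CONJUGATE in `SU(N)` —
  the centre phases of `TwistEaterUniqueness` are conjugated away by powers of the pair itself),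
  ★ `finite_centralizer_pair` (the simultaneous centraliser of such a pair is finite: it is contained in the centre),
  and the package ★ `suCenter_isolatingTwist` (existence ∧ uniqueness modulo conjugation ∧ finite centraliser), with
  `suCenter_ne_one_of_isUnit` (`ω^k · 1 ≠ 1` for `N ≥ 2`) and `suCenter_pow_card` (`(ω^k · 1)^N = 1`);
* §5, op. cit. §4.3 (corpus p0007 L44–L70, p0008 L13–L16): Lemma 1 `trace_eq_zero_of_mul_eq_smul(')`
  (`AB = z·BA`, `z ≠ 1` ⇒ `tr A = tr B = 0`), `trace_pow_mul_pow_eq_zero_of_not_dvd(')` (`tr(A^m B^n) = 0` unless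
  `N ∣ m` and `N ∣ n`), ★ `eq_zero_of_commute_pair_of_trace_eq_zero` (NO CONSTANT ADJOINT ZERO MODE: a traceless matrix
  commuting with a generating pair vanishes), `exists_pow_card_eq_smul_one(')` (`A^N`, `B^N` are non-zero scalars), and
  Theorem 1 ★ `linearIndependent_pow_mul_pow` ∕ `span_pow_mul_pow_eq_top` ('t HOOFT'S MATRIX BASIS: the `N²` products
  `A^a B^b`, `a, b < N`, are a basis of the complex `N × N` matrices — the colour-momentum decomposition of twisted boxes);
* §6 (colour momentum; García Pérez–González-Arroyo–Okawa 2014 §2–§3): `mul_pow_mul_pow_mul_conjTranspose` ∕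
  `conj_pow_mul_pow_eq_smul` (`A e_{ab} Aᴴ = ω^b e_{ab}`, `B e_{ab} Bᴴ = ω^{−a} e_{ab}` for a unitary pair, `e_{ab} = A^aB^b`),
  ★ `trace_conjTranspose_pow_mul_pow_mul` (HILBERT–SCHMIDT ORTHOGONALITY `tr(e_{ab}ᴴ e_{a'b'}) = N δ`),
  `re_le_cos_of_pow_eq_one` ∕ `four_mul_sin_sq_le_norm_one_sub_sq` (`4 sin²(π/N) ≤ |1 − ζ|²` for an `N`-th root `ζ ≠ 1`),
  `four_mul_sin_sq_le_pair` («pair gap»), `sixteen_div_sq_le_four_mul_sin_sq` (`16/N² ≤ 4 sin²(π/N)`),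
  `trace_conjTranspose_sum_smul_pow_mul_pow` (`‖Σ d_p e_p‖²_HS = N Σ|d_p|²`), `trace_pow_mul_pow`, and
  ★ `twistedLaplacian_gap`: for traceless `Φ`, `‖AΦAᴴ − Φ‖²_HS + ‖BΦBᴴ − Φ‖²_HS ≥ 4 sin²(π/N)·‖Φ‖²_HS` — the one-site kernel of
  the twisted-box fluctuation operator has NO ZERO MODE and an explicit gap (the stockroom's `mu1_ge` made structural).

Consumers.  The package is literally the hypothesis `HasIsolatingTwist (SU(N)) (ω^k·1)` of the crux line
`Cruxes/IRcof/Lines/twisted_slab_continuity.lean` (ideator ym-ir-idea-20, anchors T1/T2: «'t Hooft's twist-eating pair is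
unique modulo gauge and leaves no flat direction (`SU(N)` with `z` a generator of `Z_N`: clock and shift)»), making those
obligations non-vacuous for type `A_{N−1}`; with `TwistedSectorClassicalRate.isTwistedFlat_iff_exists_gaugeTransform_eaterConfig`
it says that the zero-action configurations of a generator-twisted `SU(N)` box are unique modulo gauge and centre.

HONEST FRAMING: finite-dimensional linear algebra (the Stone–von Neumann theorem for `ℤ/N`); nothing here is a statement
about the twisted partition function at finite `β`, a femto-box spectrum, a mass gap or the Yang–Mills gap (Clay), which
are NOT proved; `R4` closes only `BalabanLadder.UV`.

References: A. González-Arroyo, *Yang–Mills fields on the four-dimensional torus I*, hep-th/9807108, §4.2 (corpus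
`paper:arxiv-hep-th_9807108` p0005 L96–L113, p0006 L24–L76, p0007 L6–L8); M. García Pérez, A. González-Arroyo, M. Okawa,
IJMPA 29 (2014) 1445001, §2–§3 (twisted Eguchi–Kawai perturbation theory: momenta quantised in units of `2π/N` away from
zero); J. Schwinger, *Unitary operator bases*, PNAS 46 (1960) 570, §1; G. 't Hooft, Nucl. Phys.
B 153 (1979) 141, §4; H. Weyl, *The Theory of Groups and Quantum Mechanics* (1931), Ch. IV §14.
-/

noncomputable section

open scoped Matrix

namespace Literature.MathematicalPhysics.QuantumLattice

variable {N : ℕ}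

/-! ## §1 A pair with a primitive commutation phase has trivial commutant -/

section Commutant

/-- **Weyl–'t Hooft pairs with a primitive phase are irreducible.**  If `A`, `B` are invertible complex `N × N`
matrices with `A B = ω · B A`, `ω` a primitive `N`-th root of unity, then every matrix commuting with both is a scalar
(«the representation is irreducible if `p₁ = N`»; Schwinger's unitary operator basis).  Proof: eigenvector chain
`B^k v` of `A` with the `N` distinct eigenvalues `ω^k λ`. [cite: Gonzalezarroyo1998, §4.2] [cite: Schwinger1960, §1] -/
theorem exists_eq_smul_one_of_commute_pair [NeZero N] {A B M : Matrix (Fin N) (Fin N) ℂ} {ω : ℂ}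
    (hA : IsUnit A) (hB : IsUnit B) (hω : IsPrimitiveRoot ω N) (hAB : A * B = ω • (B * A))
    (hMA : M * A = A * M) (hMB : M * B = B * M) : ∃ c : ℂ, M = c • (1 : Matrix (Fin N) (Fin N) ℂ) := by
  classical
  haveI : Inhabited (Fin N) := ⟨0⟩
  -- an eigenvector of `A`
  set f : Module.End ℂ (Fin N → ℂ) := Matrix.toLin' A with hf
  obtain ⟨μ, hμ⟩ := Module.End.exists_eigenvalue f
  obtain ⟨v, hv⟩ := hμ.exists_hasEigenvector
  have hv0 : v ≠ 0 := hv.right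
  have hAv : A *ᵥ v = μ • v := by
    have h := hv.apply_eq_smul
    rwa [hf, Matrix.toLin'_apply] at h
  have hAinj : Function.Injective A.mulVec := Matrix.mulVec_injective_iff_isUnit.2 hA
  have hμ0 : μ ≠ 0 := by
    intro hμ0
    apply hv0
    apply hAinj
    rw [hAv, hμ0, zero_smul, Matrix.mulVec_zero]
  -- the chain `w k = B^k v` of eigenvectors of `A` with eigenvalues `ω^k μ`
  set w : Fin N → (Fin N → ℂ) := fun k => (B ^ (k : ℕ)) *ᵥ v with hw
  have hAw : ∀ k : Fin N, A *ᵥ w k = (ω ^ (k : ℕ) * μ) • w k := by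
    intro k
    simp only [hw]
    rw [Matrix.mulVec_mulVec, TwistEaterUniqueness.mul_pow_eq_smul hAB, Matrix.smul_mulVec,
      ← Matrix.mulVec_mulVec, hAv, Matrix.mulVec_smul, smul_smul]
  have hw0 : ∀ k : Fin N, w k ≠ 0 := by
    intro k hk
    apply hv0
    apply Matrix.mulVec_injective_iff_isUnit.2 (hB.pow (k : ℕ))
    change w k = _
    rw [hk, Matrix.mulVec_zero]
  have heig : ∀ k : Fin N, f.HasEigenvector (ω ^ (k : ℕ) * μ) (w k) := by
    intro k
    refine ⟨?_, hw0 k⟩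
    rw [Module.End.mem_eigenspace_iff, hf, Matrix.toLin'_apply, hAw]
  have hinj : Function.Injective (fun k : Fin N => ω ^ (k : ℕ) * μ) := by
    intro j k hjk
    have h : ω ^ (j : ℕ) = ω ^ (k : ℕ) := mul_right_cancel₀ hμ0 hjk
    exact Fin.ext (hω.pow_inj j.2 k.2 h)
  have hli : LinearIndependent ℂ w := f.eigenvectors_linearIndependent' _ hinj w heig
  have hcard : Fintype.card (Fin N) = Module.finrank ℂ (Fin N → ℂ) := by
    rw [Fintype.card_fin, Module.finrank_fin_fun]
  let b : Module.Basis (Fin N) ℂ (Fin N → ℂ) := basisOfLinearIndependentOfCardEqFinrank hli hcard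
  have hb : ⇑b = w := coe_basisOfLinearIndependentOfCardEqFinrank hli hcard
  -- coordinates in the basis `b`
  have hcoord : ∀ d : Fin N → ℂ, b.equivFun (∑ k, d k • w k) = d := by
    intro d
    rw [← hb, ← b.equivFun_symm_apply, LinearEquiv.apply_symm_apply]
  -- `M v` lies in the `μ`-eigenspace of `A`, which is the line through `v = w 0`
  set u : Fin N → ℂ := M *ᵥ v with hu
  have hAu : A *ᵥ u = μ • u := by
    rw [hu, Matrix.mulVec_mulVec, ← hMA, ← Matrix.mulVec_mulVec, hAv, Matrix.mulVec_smul]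
  set c : Fin N → ℂ := b.equivFun u with hc
  have hu_sum : u = ∑ k, c k • w k := by
    have h := b.sum_equivFun u
    rw [hb] at h
    exact h.symm
  have h1 : A *ᵥ u = ∑ k, (c k * (ω ^ (k : ℕ) * μ)) • w k := by
    rw [hu_sum, Matrix.mulVec_sum]
    refine Finset.sum_congr rfl fun k _ => ?_
    rw [Matrix.mulVec_smul, hAw, smul_smul]
  have h2 : A *ᵥ u = ∑ k, (c k * μ) • w k := by
    rw [hAu, hu_sum, Finset.smul_sum]
    refine Finset.sum_congr rfl fun k _ => ?_
    rw [smul_smul, mul_comm]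
  have hck : ∀ k : Fin N, k ≠ 0 → c k = 0 := by
    intro k hk
    have h := congrArg b.equivFun (h1.symm.trans h2)
    rw [hcoord, hcoord] at h
    have hk' := congrFun h k
    have hωk : ω ^ (k : ℕ) ≠ 1 :=
      hω.pow_ne_one_of_pos_of_lt (fun h0 => hk (Fin.ext h0)) k.2
    -- `c k * (ω^k μ) = c k * μ` with `ω^k ≠ 1`, `μ ≠ 0`
    have : c k * μ * (ω ^ (k : ℕ) - 1) = 0 := by
      have e : c k * (ω ^ (k : ℕ) * μ) = c k * μ := hk'
      linear_combination e
    rcases mul_eq_zero.1 this with h' | h'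
    · rcases mul_eq_zero.1 h' with h'' | h''
      · exact h''
      · exact absurd h'' hμ0
    · exact absurd (sub_eq_zero.1 h') hωk
  have hw_zero : w 0 = v := by
    simp only [hw]
    rw [Fin.val_zero, pow_zero, Matrix.one_mulVec]
  have hMv : M *ᵥ v = c 0 • v := by
    rw [← hu, hu_sum, Finset.sum_eq_single (0 : Fin N) (fun k _ hk => by rw [hck k hk, zero_smul])
      (fun h => absurd (Finset.mem_univ _) h), hw_zero]
  -- `M` acts as `c 0` on the whole chain
  have hMBk : ∀ k : ℕ, M * B ^ k = B ^ k * M := fun k => ((Commute.pow_right hMB k)).eq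
  have hMw : ∀ k : Fin N, M *ᵥ w k = c 0 • w k := by
    intro k
    simp only [hw]
    rw [Matrix.mulVec_mulVec, hMBk, ← Matrix.mulVec_mulVec, hMv, Matrix.mulVec_smul]
  refine ⟨c 0, ?_⟩
  apply Matrix.toLin'.injective
  refine b.ext fun k => ?_
  rw [Matrix.toLin'_apply, Matrix.toLin'_apply, hb, hMw, Matrix.smul_mulVec, Matrix.one_mulVec]

/-- **A family containing a Weyl–'t Hooft pair with a primitive phase is irreducible** (its commutant is already the
commutant of the pair). [cite: Gonzalezarroyo1998, §4.2] -/
theorem isIrreducibleFamily_of_pair [NeZero N] {ι : Type*} (F : ι → Matrix (Fin N) (Fin N) ℂ) (i j : ι)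
    {ω : ℂ} (hi : IsUnit (F i)) (hj : IsUnit (F j)) (hω : IsPrimitiveRoot ω N)
    (hij : F i * F j = ω • (F j * F i)) : IsIrreducibleFamily F :=
  fun _ hM => exists_eq_smul_one_of_commute_pair hi hj hω hij (hM i) (hM j)

end Commutant

/-! ## §2 Centre phases: `ω^k` is primitive iff `k` is a unit; powers of a generating centre element of `SU(N)`
(the group law `suCenter_zero` ∕ `suCenter_add` ∕ `centerPhase_add` is the tree's, `QuantumFieldTheory/QCDTwistedSlab.lean`) -/

section Centre

variable (N)

/-- The centre phase is a power of the standard primitive root: `centerPhase N k = exp(2πi/N)^{k.val}` (the phases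
`exp(2πi n_{μν}/N)` of the centre `Z_N`). [cite: Gonzalezarroyo1998, §4.2] [cite: tHooft1979Flux, §2 (2.2)] -/
theorem centerPhase_eq_exp_pow (k : ZMod N) :
    centerPhase N k = Complex.exp (2 * Real.pi * Complex.I / N) ^ k.val := by
  rw [centerPhase, ← Complex.exp_nat_mul]
  congr 1
  push_cast
  ring

/-- **`ω^k` is a primitive `N`-th root of unity when `k` is a unit of `ℤ/N`** (the twist `n₀₁ = k` coprime to `N`).
[cite: Gonzalezarroyo1998, §4.2] -/
theorem isPrimitiveRoot_centerPhase [NeZero N] {k : ZMod N} (hk : IsUnit k) :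
    IsPrimitiveRoot (centerPhase N k) N := by
  rw [centerPhase_eq_exp_pow]
  obtain ⟨u, rfl⟩ := hk
  exact (Complex.isPrimitiveRoot_exp N (NeZero.ne N)).pow_of_coprime _ (ZMod.val_coe_unit_coprime u)

/-- Natural multiples: `ω^{m k}·1 = (ω^k·1)^m` (powers in the centre `Z_N`). [cite: tHooft1979Flux, §2 (2.2)] -/
theorem suCenter_natCast_mul [NeZero N] (m : ℕ) (k : ZMod N) :
    suCenter N ((m : ZMod N) * k) = suCenter N k ^ m := by
  induction m with
  | zero => rw [Nat.cast_zero, zero_mul, QuantumFieldTheory.suCenter_zero, pow_zero]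
  | succ m ih => rw [Nat.cast_succ, add_mul, one_mul, QuantumFieldTheory.suCenter_add, ih, pow_succ]

/-- **Every centre phase is a power of a generating one**: for a unit `k`, `ω^{k'}·1 = (ω^k·1)^m` for some `m`.
[cite: Gonzalezarroyo1998, §4.2] -/
theorem exists_suCenter_eq_pow [NeZero N] {k : ZMod N} (hk : IsUnit k) (k' : ZMod N) :
    ∃ m : ℕ, suCenter N k' = suCenter N k ^ m := by
  obtain ⟨u, rfl⟩ := hk
  refine ⟨(k' * ((u⁻¹ : (ZMod N)ˣ) : ZMod N)).val, ?_⟩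
  rw [← suCenter_natCast_mul, ZMod.natCast_zmod_val, mul_assoc, Units.inv_mul, mul_one]

/-- `(ω^k·1)^N = 1`: the twist has finite order dividing `N`. [cite: tHooft1979Flux, §2 (2.2)] -/
theorem suCenter_pow_card [NeZero N] (k : ZMod N) : suCenter N k ^ N = 1 := by
  rw [← suCenter_natCast_mul, ZMod.natCast_self, zero_mul, QuantumFieldTheory.suCenter_zero]

/-- For `N ≥ 2` and a unit `k`, the centre element `ω^k·1` is non-trivial. [cite: tHooft1979Flux, §2 (2.2)] -/
theorem suCenter_ne_one_of_isUnit (hN : 2 ≤ N) {k : ZMod N} (hk : IsUnit k) :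
    (suCenter N k : Matrix.specialUnitaryGroup (Fin N) ℂ) ≠ 1 := by
  haveI : NeZero N := ⟨by omega⟩
  intro h
  have h1 := congrArg (fun g : Matrix.specialUnitaryGroup (Fin N) ℂ => (g : Matrix (Fin N) (Fin N) ℂ) 0 0) h
  simp only [coe_suCenter, Matrix.smul_apply, Matrix.one_apply_eq, smul_eq_mul, mul_one] at h1
  exact (isPrimitiveRoot_centerPhase N hk).ne_one hN h1

end Centre

/-! ## §3 Twist eaters with a generating plane are irreducible: `TwistEaterUniqueness` hypothesis-free -/

section Eaters

/-- The matrix of an `SU(N)` element is invertible. [folklore] -/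
private theorem isUnit_coe_specialUnitaryGroup (A : Matrix.specialUnitaryGroup (Fin N) ℂ) :
    IsUnit (A : Matrix (Fin N) (Fin N) ℂ) :=
  ⟨⟨(A : Matrix (Fin N) (Fin N) ℂ), star (A : Matrix (Fin N) (Fin N) ℂ), A.prop.1.2, A.prop.1.1⟩, rfl⟩

/-- The eater relation on a plane with twist `ω^k·1`, at matrix level: `Γ_μ Γ_ν = ω^k · Γ_ν Γ_μ` (the relation
(twisteat) of the source). [cite: Gonzalezarroyo1998, §4.2] -/
theorem coe_mul_eq_smul_of_isTwistEater {d : ℕ} {z : Twist d (Matrix.specialUnitaryGroup (Fin N) ℂ)}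
    {Γ : Fin d → Matrix.specialUnitaryGroup (Fin N) ℂ} (hΓ : IsTwistEater z Γ) {μ ν : Fin d} (hμν : μ < ν)
    {k : ZMod N} (hz : z ⟨(μ, ν), hμν⟩ = suCenter N k) :
    (Γ μ : Matrix (Fin N) (Fin N) ℂ) * Γ ν = centerPhase N k • ((Γ ν : Matrix (Fin N) (Fin N) ℂ) * Γ μ) := by
  have h := congrArg Subtype.val (hΓ μ ν hμν)
  rw [hz] at h
  change (Γ μ : Matrix (Fin N) (Fin N) ℂ) * Γ ν =
    (centerPhase N k • (1 : Matrix (Fin N) (Fin N) ℂ)) * ((Γ ν : Matrix (Fin N) (Fin N) ℂ) * Γ μ) at h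
  rwa [Matrix.smul_mul, Matrix.one_mul] at h

/-- **Twist eaters of a twist with a generating plane are irreducible**: if the plane `(μ, ν)` of the twist carries
`ω^k·1` with `k` a unit of `ℤ/N` (`n_{μν}` coprime to `N`), every solution of `Γ_μ Γ_ν = z_{μν} Γ_ν Γ_μ` in `SU(N)`
has trivial commutant — the irreducibility hypothesis of `TwistEaterUniqueness` is automatic.
[cite: Gonzalezarroyo1998, §4.2] -/
theorem isIrreducibleFamily_of_isTwistEater [NeZero N] {d : ℕ}
    {z : Twist d (Matrix.specialUnitaryGroup (Fin N) ℂ)} {Γ : Fin d → Matrix.specialUnitaryGroup (Fin N) ℂ}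
    (hΓ : IsTwistEater z Γ) {μ ν : Fin d} (hμν : μ < ν) {k : ZMod N} (hk : IsUnit k)
    (hz : z ⟨(μ, ν), hμν⟩ = suCenter N k) :
    IsIrreducibleFamily (fun τ => (Γ τ : Matrix (Fin N) (Fin N) ℂ)) :=
  isIrreducibleFamily_of_pair (fun τ => (Γ τ : Matrix (Fin N) (Fin N) ℂ)) μ ν
    (isUnit_coe_specialUnitaryGroup (Γ μ)) (isUnit_coe_specialUnitaryGroup (Γ ν))
    (isPrimitiveRoot_centerPhase N hk) (coe_mul_eq_smul_of_isTwistEater hΓ hμν hz)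

/-- **Uniqueness of twist eaters for a twist with a generating plane, with NO irreducibility hypothesis**: two
solutions `Γ, Γ'` in `SU(N)` of the same twist are related by `Γ'_μ = ω^{k_μ} Ω Γ_μ Ω⁻¹` («the representation is
irreducible, and hence unique modulo the transformations (multipl)–(equivalence)»).
[cite: Gonzalezarroyo1998, §4.2] [cite: GarciaperezGonzalezarroyoOkawa2014, §2] -/
theorem twistEater_unique_of_isUnit [NeZero N] {d : ℕ}
    {z : Twist d (Matrix.specialUnitaryGroup (Fin N) ℂ)} {Γ Γ' : Fin d → Matrix.specialUnitaryGroup (Fin N) ℂ}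
    (hΓ : IsTwistEater z Γ) (hΓ' : IsTwistEater z Γ') {μ ν : Fin d} (hμν : μ < ν) {k : ZMod N} (hk : IsUnit k)
    (hz : z ⟨(μ, ν), hμν⟩ = suCenter N k) :
    ∃ (Ω : Matrix.specialUnitaryGroup (Fin N) ℂ) (k : Fin d → ZMod N), ∀ τ,
      Γ' τ = (suCenter N (k τ) : Matrix.specialUnitaryGroup (Fin N) ℂ) * (Ω * Γ τ * Ω⁻¹) :=
  TwistEaterUniqueness_holds N d z Γ Γ' hΓ hΓ' (isIrreducibleFamily_of_isTwistEater hΓ hμν hk hz)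
    (isIrreducibleFamily_of_isTwistEater hΓ' hμν hk hz)

/-- **Finiteness of the classical vacua modulo gauge for a twist with a generating plane** (unconditional form of
`TwistEaterUniqueness.finite_classes`): there is a finite set `S` of `d`-tuples such that EVERY twist eater of `z`
is a global gauge rotation of a member of `S`. [cite: GarciaperezGonzalezarroyoOkawa2014, §2] [cite: Gonzalezarroyo1998, §4.2] -/
theorem twistEater_finite_classes_of_isUnit [NeZero N] {d : ℕ}
    (z : Twist d (Matrix.specialUnitaryGroup (Fin N) ℂ)) {μ ν : Fin d} (hμν : μ < ν) {k : ZMod N} (hk : IsUnit k)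
    (hz : z ⟨(μ, ν), hμν⟩ = suCenter N k) :
    ∃ S : Finset (Fin d → Matrix.specialUnitaryGroup (Fin N) ℂ),
      ∀ Γ : Fin d → Matrix.specialUnitaryGroup (Fin N) ℂ, IsTwistEater z Γ →
        ∃ Γ₀ ∈ S, ∃ Ω : Matrix.specialUnitaryGroup (Fin N) ℂ, ∀ τ, Γ τ = Ω * Γ₀ τ * Ω⁻¹ := by
  obtain ⟨S, hS⟩ := TwistEaterUniqueness_holds.finite_classes N d z
  exact ⟨S, fun Γ hΓ => hS Γ hΓ (isIrreducibleFamily_of_isTwistEater hΓ hμν hk hz)⟩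

end Eaters

/-! ## §4 The `SU(N)` clock–shift twist is isolating: existence, uniqueness modulo conjugation, finite centraliser -/

section Pair

/-- In a group, `a b a⁻¹ = c b` with `c` central iterates to `aⁿ b a⁻ⁿ = cⁿ b`. [folklore] -/
private theorem pow_mul_mul_pow_inv_of_central {G : Type*} [Group G] {a b c : G} (hc : c ∈ Subgroup.center G)
    (h : a * b * a⁻¹ = c * b) (n : ℕ) : a ^ n * b * (a ^ n)⁻¹ = c ^ n * b := by
  induction n with
  | zero => simp
  | succ n ih =>
    have hcn : a * c ^ n = c ^ n * a := (Subgroup.mem_center_iff.1 (Subgroup.pow_mem _ hc n) a)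
    calc a ^ (n + 1) * b * (a ^ (n + 1))⁻¹ = a * (a ^ n * b * (a ^ n)⁻¹) * a⁻¹ := by
          rw [pow_succ']; group
      _ = (a * c ^ n) * b * a⁻¹ := by rw [ih]; group
      _ = c ^ n * (a * b * a⁻¹) := by rw [hcn]; group
      _ = c ^ (n + 1) * b := by rw [h, pow_succ]; group

/-- From `a b a⁻¹ b⁻¹ = c` (central `c`): `a b a⁻¹ = c b` and `b⁻¹ a b = c a`, i.e. conjugation by `a` multiplies `b`
by `c` and conjugation by `b⁻¹` multiplies `a` by `c`. [folklore] -/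
private theorem conj_eq_of_commutator_eq {G : Type*} [Group G] {a b c : G} (hc : c ∈ Subgroup.center G)
    (h : a * b * a⁻¹ * b⁻¹ = c) : a * b * a⁻¹ = c * b ∧ b⁻¹ * a * b⁻¹⁻¹ = c * a := by
  have h1 : a * b * a⁻¹ = c * b := by rw [← h]; group
  refine ⟨h1, ?_⟩
  have hca : a⁻¹ * c = c * a⁻¹ := Subgroup.mem_center_iff.1 hc a⁻¹
  have h2 : a * b = c * b * a := by rw [← h1]; group
  calc b⁻¹ * a * b⁻¹⁻¹ = b⁻¹ * (a * b) := by group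
    _ = b⁻¹ * (c * b * a) := by rw [h2]
    _ = (b⁻¹ * c) * b * a := by group
    _ = (c * b⁻¹) * b * a := by rw [Subgroup.mem_center_iff.1 hc b⁻¹]
    _ = c * a := by group

/-- **Existence of an `SU(N)` pair with any prescribed central commutator** `A B A⁻¹ B⁻¹ = ω^k·1` — the clock and
shift matrices `Γ₀ = Q_N^{k}`, `Γ₁ = P_N⁺`; here read off the tree's existence theorem `EaterIffOrthogonal_holds` for the
orthogonal twist `n₀₁ = k`, all other `n_{μν} = 0` (`κ(n) = 0`). [cite: Gonzalezarroyo1998, §4.2] -/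
theorem exists_pair_commutator_eq_suCenter [NeZero N] (k : ZMod N) :
    ∃ A B : Matrix.specialUnitaryGroup (Fin N) ℂ,
      A * B * A⁻¹ * B⁻¹ = (suCenter N k : Matrix.specialUnitaryGroup (Fin N) ℂ) := by
  classical
  -- the twist tensor `n₀₁ = k`, zero elsewhere, is orthogonal
  set n : Plane 4 → ZMod N := fun p => if p.1 = (0, 1) then k else 0 with hn
  have hκ : TwistedSector.twistKappa n = 0 := by
    simp [TwistedSector.twistKappa, hn]
  obtain ⟨Γ, hΓ⟩ := (TwistedSector.EaterIffOrthogonal_holds N n).2 hκ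
  have h01 : (0 : Fin 4) < 1 := by decide
  have h := hΓ 0 1 h01
  have hz : (twistOfTensor N n ⟨((0 : Fin 4), (1 : Fin 4)), h01⟩ : Matrix.specialUnitaryGroup (Fin N) ℂ) =
      suCenter N k := by
    simp [twistOfTensor, hn]
  rw [hz] at h
  refine ⟨Γ 0, Γ 1, ?_⟩
  rw [h]
  group

/-- **Uniqueness modulo conjugation of the `SU(N)` pair with a GENERATING central commutator** («unique modulo similarity
transformations (if `N` and `n₀₁` are coprime)»): if `k` is a unit of `ℤ/N`, any two pairs `(A, B)`, `(A', B')` in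
`SU(N)` with `A B A⁻¹ B⁻¹ = A' B' A'⁻¹ B'⁻¹ = ω^k·1` are simultaneously conjugate, `A' = g A g⁻¹`, `B' = g B g⁻¹`.
Proof: `TwistEaterUniqueness` (irreducibility being automatic, §3) gives `A' = ω^{k₀} Ω A Ω⁻¹`, `B' = ω^{k₁} Ω B Ω⁻¹`;
since `ω^k` generates the centre, `ω^{k₀} = (ω^k)^{m₀}`, `ω^{k₁} = (ω^k)^{m₁}`, and conjugating by `A₁^{m₁} (B₁⁻¹)^{m₀}`
(`A₁ = Ω A Ω⁻¹`, `B₁ = Ω B Ω⁻¹`) produces exactly these phases. [cite: Gonzalezarroyo1998, §4.2] -/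
theorem pair_conj_of_commutator_eq_suCenter [NeZero N] {k : ZMod N} (hk : IsUnit k)
    {A B A' B' : Matrix.specialUnitaryGroup (Fin N) ℂ}
    (h : A * B * A⁻¹ * B⁻¹ = (suCenter N k : Matrix.specialUnitaryGroup (Fin N) ℂ))
    (h' : A' * B' * A'⁻¹ * B'⁻¹ = (suCenter N k : Matrix.specialUnitaryGroup (Fin N) ℂ)) :
    ∃ g : Matrix.specialUnitaryGroup (Fin N) ℂ, A' = g * A * g⁻¹ ∧ B' = g * B * g⁻¹ := by
  classical
  set c : Matrix.specialUnitaryGroup (Fin N) ℂ := (suCenter N k : Matrix.specialUnitaryGroup (Fin N) ℂ) with hcdef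
  have hc : c ∈ Subgroup.center (Matrix.specialUnitaryGroup (Fin N) ℂ) := (suCenter N k).2
  -- the two pairs as twist eaters of the one-plane twist `z ≡ ω^k·1` in `d = 2`
  set z : Twist 2 (Matrix.specialUnitaryGroup (Fin N) ℂ) := fun _ => suCenter N k with hzdef
  have h01 : (0 : Fin 2) < 1 := by decide
  have eater : ∀ {X Y : Matrix.specialUnitaryGroup (Fin N) ℂ}, X * Y * X⁻¹ * Y⁻¹ = c →
      IsTwistEater z ![X, Y] := by
    intro X Y hXY μ ν hμν
    have hXY' : X * Y = c * (Y * X) := by rw [← hXY]; group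
    fin_cases μ <;> fin_cases ν
    · exact absurd hμν (lt_irrefl _)
    · simpa [hzdef] using hXY'
    · exact absurd hμν (by decide)
    · exact absurd hμν (lt_irrefl _)
  obtain ⟨Ω, kv, hkv⟩ := twistEater_unique_of_isUnit (eater h) (eater h') h01 hk (by rw [hzdef])
  have hA' : A' = (suCenter N (kv 0) : Matrix.specialUnitaryGroup (Fin N) ℂ) * (Ω * A * Ω⁻¹) := by
    simpa using hkv 0
  have hB' : B' = (suCenter N (kv 1) : Matrix.specialUnitaryGroup (Fin N) ℂ) * (Ω * B * Ω⁻¹) := by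
    simpa using hkv 1
  -- the phases are powers of the generating commutator
  obtain ⟨m₀, hm₀⟩ := exists_suCenter_eq_pow N hk (kv 0)
  obtain ⟨m₁, hm₁⟩ := exists_suCenter_eq_pow N hk (kv 1)
  have hc₀ : (suCenter N (kv 0) : Matrix.specialUnitaryGroup (Fin N) ℂ) = c ^ m₀ := by
    rw [hm₀, hcdef, Subgroup.coe_pow]
  have hc₁ : (suCenter N (kv 1) : Matrix.specialUnitaryGroup (Fin N) ℂ) = c ^ m₁ := by
    rw [hm₁, hcdef, Subgroup.coe_pow]
  -- the conjugated pair has the same (central) commutator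
  set A₁ := Ω * A * Ω⁻¹ with hA₁
  set B₁ := Ω * B * Ω⁻¹ with hB₁
  have hcomm₁ : A₁ * B₁ * A₁⁻¹ * B₁⁻¹ = c := by
    have hΩc : Ω * c * Ω⁻¹ = c := by
      rw [Subgroup.mem_center_iff.1 hc Ω]; group
    calc A₁ * B₁ * A₁⁻¹ * B₁⁻¹ = Ω * (A * B * A⁻¹ * B⁻¹) * Ω⁻¹ := by rw [hA₁, hB₁]; group
      _ = c := by rw [h, hΩc]
  obtain ⟨hconjA, hconjB⟩ := conj_eq_of_commutator_eq hc hcomm₁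
  -- conjugation by `A₁^{m₁} (B₁⁻¹)^{m₀}`
  have e1 : (B₁⁻¹) ^ m₀ * A₁ * ((B₁⁻¹) ^ m₀)⁻¹ = c ^ m₀ * A₁ := pow_mul_mul_pow_inv_of_central hc hconjB m₀
  have e2 : (B₁⁻¹) ^ m₀ * B₁ * ((B₁⁻¹) ^ m₀)⁻¹ = B₁ := by
    rw [inv_pow]; group
  have e3 : A₁ ^ m₁ * B₁ * (A₁ ^ m₁)⁻¹ = c ^ m₁ * B₁ := pow_mul_mul_pow_inv_of_central hc hconjA m₁
  have e4 : A₁ ^ m₁ * A₁ * (A₁ ^ m₁)⁻¹ = A₁ := by group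
  have hcm : A₁ ^ m₁ * c ^ m₀ = c ^ m₀ * A₁ ^ m₁ :=
    Subgroup.mem_center_iff.1 (Subgroup.pow_mem _ hc m₀) (A₁ ^ m₁)
  set g := A₁ ^ m₁ * (B₁⁻¹) ^ m₀ * Ω with hg
  refine ⟨g, ?_, ?_⟩
  · calc A' = c ^ m₀ * A₁ := by rw [hA', hc₀]
      _ = c ^ m₀ * (A₁ ^ m₁ * A₁ * (A₁ ^ m₁)⁻¹) := by rw [e4]
      _ = (A₁ ^ m₁ * c ^ m₀) * A₁ * (A₁ ^ m₁)⁻¹ := by rw [hcm]; group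
      _ = A₁ ^ m₁ * (c ^ m₀ * A₁) * (A₁ ^ m₁)⁻¹ := by group
      _ = A₁ ^ m₁ * ((B₁⁻¹) ^ m₀ * A₁ * ((B₁⁻¹) ^ m₀)⁻¹) * (A₁ ^ m₁)⁻¹ := by rw [e1]
      _ = g * A * g⁻¹ := by rw [hg, hA₁]; group
  · calc B' = c ^ m₁ * B₁ := by rw [hB', hc₁]
      _ = A₁ ^ m₁ * B₁ * (A₁ ^ m₁)⁻¹ := e3.symm
      _ = A₁ ^ m₁ * ((B₁⁻¹) ^ m₀ * B₁ * ((B₁⁻¹) ^ m₀)⁻¹) * (A₁ ^ m₁)⁻¹ := by rw [e2]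
      _ = g * B * g⁻¹ := by rw [hg, hB₁]; group

/-- **The simultaneous centraliser of an `SU(N)` pair with a generating central commutator is finite** (it consists of
scalars by §1, hence of the `N` centre elements). [cite: Gonzalezarroyo1998, §4.2] -/
theorem finite_centralizer_pair [NeZero N] {k : ZMod N} (hk : IsUnit k)
    {A B : Matrix.specialUnitaryGroup (Fin N) ℂ}
    (h : A * B * A⁻¹ * B⁻¹ = (suCenter N k : Matrix.specialUnitaryGroup (Fin N) ℂ)) :
    {g : Matrix.specialUnitaryGroup (Fin N) ℂ | g * A * g⁻¹ = A ∧ g * B * g⁻¹ = B}.Finite := by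
  classical
  have hNpos : 0 < N := Nat.pos_of_ne_zero (NeZero.ne N)
  -- matrix-level commutation relation of the pair
  have hAB : (A : Matrix (Fin N) (Fin N) ℂ) * B = centerPhase N k • ((B : Matrix (Fin N) (Fin N) ℂ) * A) := by
    have h1 : A * B = (suCenter N k : Matrix.specialUnitaryGroup (Fin N) ℂ) * (B * A) := by rw [← h]; group
    have h2 := congrArg Subtype.val h1
    change (A : Matrix (Fin N) (Fin N) ℂ) * B =
      (centerPhase N k • (1 : Matrix (Fin N) (Fin N) ℂ)) * ((B : Matrix (Fin N) (Fin N) ℂ) * A) at h2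
    rwa [Matrix.smul_mul, Matrix.one_mul] at h2
  -- every element of the centraliser is a scalar matrix
  have hscalar : ∀ g ∈ {g : Matrix.specialUnitaryGroup (Fin N) ℂ | g * A * g⁻¹ = A ∧ g * B * g⁻¹ = B},
      ∃ c : ℂ, (g : Matrix (Fin N) (Fin N) ℂ) = c • 1 := by
    rintro g ⟨hgA, hgB⟩
    have hgA' : (g : Matrix (Fin N) (Fin N) ℂ) * A = (A : Matrix (Fin N) (Fin N) ℂ) * g := by
      have := congrArg Subtype.val (mul_inv_eq_iff_eq_mul.1 hgA); exact this
    have hgB' : (g : Matrix (Fin N) (Fin N) ℂ) * B = (B : Matrix (Fin N) (Fin N) ℂ) * g := by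
      have := congrArg Subtype.val (mul_inv_eq_iff_eq_mul.1 hgB); exact this
    exact exists_eq_smul_one_of_commute_pair (isUnit_coe_specialUnitaryGroup A) (isUnit_coe_specialUnitaryGroup B)
      (isPrimitiveRoot_centerPhase N hk) hAB hgA' hgB'
  -- injection into the `N`-th roots of unity by the `(0,0)` entry
  let e : Matrix.specialUnitaryGroup (Fin N) ℂ → ℂ := fun g => (g : Matrix (Fin N) (Fin N) ℂ) 0 0
  refine Set.Finite.of_finite_image (f := e) ?_ ?_
  · refine (Polynomial.nthRootsFinset N (1 : ℂ)).finite_toSet.subset ?_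
    rintro x ⟨g, hg, rfl⟩
    obtain ⟨c, hc⟩ := hscalar g hg
    have hdet : (g : Matrix (Fin N) (Fin N) ℂ).det = 1 := (Matrix.mem_specialUnitaryGroup_iff.1 g.prop).2
    rw [hc, Matrix.det_smul, Matrix.det_one, mul_one, Fintype.card_fin] at hdet
    have hx : e g = c := by
      simp only [e, hc, Matrix.smul_apply, Matrix.one_apply_eq, smul_eq_mul, mul_one]
    rw [Finset.mem_coe, Polynomial.mem_nthRootsFinset hNpos, hx, hdet]
  · rintro g hg g' hg' hgg'
    obtain ⟨c, hc⟩ := hscalar g hg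
    obtain ⟨c', hc'⟩ := hscalar g' hg'
    have hcc : c = c' := by
      have h1 : e g = c := by simp only [e, hc, Matrix.smul_apply, Matrix.one_apply_eq, smul_eq_mul, mul_one]
      have h2 : e g' = c' := by simp only [e, hc', Matrix.smul_apply, Matrix.one_apply_eq, smul_eq_mul, mul_one]
      rw [← h1, ← h2]; exact hgg'
    apply Subtype.ext
    rw [hc, hc', hcc]

/-- ★ **The clock–shift twist of `SU(N)` is isolating.**  For `k` a unit of `ℤ/N` and `z = ω^k·1 ∈ Z(SU(N))`:
(i) `z` is the commutator of some pair; (ii) all pairs with commutator `z` form ONE simultaneous conjugation orbit;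
(iii) the simultaneous centraliser of such a pair is finite — 't Hooft's twist-eating pair is unique modulo gauge and
leaves no flat direction.  (Literally the hypothesis `HasIsolatingTwist (SU(N)) z` of the crux line
`twisted_slab_continuity`.) [cite: Gonzalezarroyo1998, §4.2] [cite: GarciaperezGonzalezarroyoOkawa2014, §2] -/
theorem suCenter_isolatingTwist [NeZero N] {k : ZMod N} (hk : IsUnit k) :
    (∃ A B : Matrix.specialUnitaryGroup (Fin N) ℂ,
        A * B * A⁻¹ * B⁻¹ = (suCenter N k : Matrix.specialUnitaryGroup (Fin N) ℂ)) ∧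
    (∀ A B A' B' : Matrix.specialUnitaryGroup (Fin N) ℂ,
        A * B * A⁻¹ * B⁻¹ = (suCenter N k : Matrix.specialUnitaryGroup (Fin N) ℂ) →
        A' * B' * A'⁻¹ * B'⁻¹ = (suCenter N k : Matrix.specialUnitaryGroup (Fin N) ℂ) →
          ∃ g : Matrix.specialUnitaryGroup (Fin N) ℂ, A' = g * A * g⁻¹ ∧ B' = g * B * g⁻¹) ∧
    (∀ A B : Matrix.specialUnitaryGroup (Fin N) ℂ,
        A * B * A⁻¹ * B⁻¹ = (suCenter N k : Matrix.specialUnitaryGroup (Fin N) ℂ) →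
          {g : Matrix.specialUnitaryGroup (Fin N) ℂ | g * A * g⁻¹ = A ∧ g * B * g⁻¹ = B}.Finite) :=
  ⟨exists_pair_commutator_eq_suCenter k, fun _ _ _ _ h h' => pair_conj_of_commutator_eq_suCenter hk h h',
    fun _ _ h => finite_centralizer_pair hk h⟩

end Pair

/-! ## §5 't Hooft's Lemma 1 and matrix basis (González-Arroyo 1998 §4.3): traces of a Weyl pair vanish, a
generating pair has no constant adjoint zero mode, and the `N²` products `A^a B^b` are a basis of the `N × N` matrices -/

section Basis

variable [NeZero N] {A B : Matrix (Fin N) (Fin N) ℂ} {ω : ℂ}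

omit [NeZero N] in
/-- **Lemma 1 of the source (trace half)**: if `A B = z · B A` with `B` invertible and `z ≠ 1`, then `tr A = 0`
(`tr A = tr(B⁻¹ A B) = z · tr A`). [cite: Gonzalezarroyo1998, §4.3 Lemma 1] -/
theorem trace_eq_zero_of_mul_eq_smul (hB : IsUnit B) (hz : ω ≠ 1) (hAB : A * B = ω • (B * A)) : A.trace = 0 := by
  obtain ⟨u, rfl⟩ := hB
  have h1 : A.trace = ω * A.trace := by
    conv_lhs => rw [← Matrix.mul_one A, ← Units.mul_inv u, ← Matrix.mul_assoc, Matrix.trace_mul_comm, hAB,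
      Matrix.mul_smul, ← Matrix.mul_assoc, Units.inv_mul, Matrix.one_mul, Matrix.trace_smul, smul_eq_mul]
  have h2 : (1 - ω) * A.trace = 0 := by linear_combination h1
  rcases mul_eq_zero.1 h2 with h | h
  · exact absurd (sub_eq_zero.1 h).symm hz
  · exact h

omit [NeZero N] in
/-- **Lemma 1 of the source (second trace)**: if `A B = z · B A` with `A` invertible, `z ≠ 0` and `z ≠ 1`, then
`tr B = 0`. [cite: Gonzalezarroyo1998, §4.3 Lemma 1] -/
theorem trace_eq_zero_of_mul_eq_smul' (hA : IsUnit A) (hz0 : ω ≠ 0) (hz : ω ≠ 1) (hAB : A * B = ω • (B * A)) :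
    B.trace = 0 := by
  have hBA : B * A = ω⁻¹ • (A * B) := by
    rw [hAB, smul_smul, inv_mul_cancel₀ hz0, one_smul]
  exact trace_eq_zero_of_mul_eq_smul hA (fun h => hz (inv_eq_one.1 h)) hBA

/-- **Traces of the products `A^m B^n` vanish off the centre**: for a Weyl pair with a primitive phase and `A`
invertible, `tr(A^m B^n) = 0` unless `N ∣ n` (conjugate by `A`: `A (A^m B^n) A⁻¹ = ω^n A^m B^n`).
[cite: Gonzalezarroyo1998, §4.3 Lemma 1] -/
theorem trace_pow_mul_pow_eq_zero_of_not_dvd (hA : IsUnit A) (hω : IsPrimitiveRoot ω N)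
    (hAB : A * B = ω • (B * A)) {m n : ℕ} (hn : ¬ N ∣ n) : (A ^ m * B ^ n).trace = 0 := by
  have hω0 : ω ^ n ≠ 0 := pow_ne_zero _ (hω.ne_zero (NeZero.ne N))
  have hω1 : ω ^ n ≠ 1 := fun h => hn ((hω.pow_eq_one_iff_dvd n).1 h)
  -- `A · (A^m B^n) = ω^n · (A^m B^n) · A`
  have hrel : A * (A ^ m * B ^ n) = ω ^ n • (A ^ m * B ^ n * A) := by
    rw [← mul_assoc, ← pow_succ', pow_succ, mul_assoc, TwistEaterUniqueness.mul_pow_eq_smul hAB n,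
      mul_smul_comm, ← mul_assoc]
  exact trace_eq_zero_of_mul_eq_smul' hA hω0 hω1 hrel

omit [NeZero N] in
/-- Companion: `tr(A^m B^n) = 0` unless `N ∣ m` (conjugate by `B`; `B` invertible).
[cite: Gonzalezarroyo1998, §4.3 Lemma 1] -/
theorem trace_pow_mul_pow_eq_zero_of_not_dvd' (hB : IsUnit B) (hω : IsPrimitiveRoot ω N)
    (hAB : A * B = ω • (B * A)) {m n : ℕ} (hm : ¬ N ∣ m) : (A ^ m * B ^ n).trace = 0 := by
  have hω1 : ω ^ m ≠ 1 := fun h => hm ((hω.pow_eq_one_iff_dvd m).1 h)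
  -- `(A^m B^n) · B = ω^m · B · (A^m B^n)`
  have hrel : A ^ m * B ^ n * B = ω ^ m • (B * (A ^ m * B ^ n)) := by
    rw [mul_assoc, ← pow_succ, pow_succ', ← mul_assoc, TwistEaterUniqueness.pow_mul_eq_smul hAB m,
      smul_mul_assoc, mul_assoc]
  exact trace_eq_zero_of_mul_eq_smul hB hω1 hrel

/-- **No constant adjoint zero mode**: a TRACELESS matrix commuting with both members of a Weyl pair with a primitive
phase vanishes (the commutant is the scalars, and the only traceless scalar matrix is `0`) — for a generating twist the
covariant constant modes of the adjoint fields are absent. [cite: Gonzalezarroyo1998, §4.2] [cite: Gonzalezarroyo1998, §4.3 Lemma 1] -/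
theorem eq_zero_of_commute_pair_of_trace_eq_zero {M : Matrix (Fin N) (Fin N) ℂ} (hA : IsUnit A) (hB : IsUnit B)
    (hω : IsPrimitiveRoot ω N) (hAB : A * B = ω • (B * A)) (hMA : M * A = A * M) (hMB : M * B = B * M)
    (htr : M.trace = 0) : M = 0 := by
  obtain ⟨c, hc⟩ := exists_eq_smul_one_of_commute_pair hA hB hω hAB hMA hMB
  rw [hc, Matrix.trace_smul, Matrix.trace_one, Fintype.card_fin, smul_eq_mul] at htr
  rcases mul_eq_zero.1 htr with h | h
  · rw [hc, h, zero_smul]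
  · exact absurd h (Nat.cast_ne_zero.2 (NeZero.ne N))

/-- **`N`-th powers of a generating pair are scalars**: `A^N = α · 1` (it commutes with `A` and, the phase being an
`N`-th root of unity, with `B`). [cite: Gonzalezarroyo1998, §4.2] -/
theorem exists_pow_card_eq_smul_one (hA : IsUnit A) (hB : IsUnit B) (hω : IsPrimitiveRoot ω N)
    (hAB : A * B = ω • (B * A)) : ∃ α : ℂ, α ≠ 0 ∧ A ^ N = α • (1 : Matrix (Fin N) (Fin N) ℂ) := by
  have hc : A ^ N * B = B * A ^ N := by
    rw [TwistEaterUniqueness.pow_mul_eq_smul hAB N, hω.pow_eq_one, one_smul]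
  obtain ⟨α, hα⟩ := exists_eq_smul_one_of_commute_pair hA hB hω hAB ((Commute.refl A).pow_left N).eq hc
  refine ⟨α, fun h0 => ?_, hα⟩
  have hu : IsUnit (A ^ N) := hA.pow N
  rw [hα, h0, zero_smul] at hu
  exact not_isUnit_zero hu

/-- Same for `B`: `B^N = β · 1`, `β ≠ 0`. [cite: Gonzalezarroyo1998, §4.2] -/
theorem exists_pow_card_eq_smul_one' (hA : IsUnit A) (hB : IsUnit B) (hω : IsPrimitiveRoot ω N)
    (hAB : A * B = ω • (B * A)) : ∃ β : ℂ, β ≠ 0 ∧ B ^ N = β • (1 : Matrix (Fin N) (Fin N) ℂ) := by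
  have hω0 : ω ≠ 0 := hω.ne_zero (NeZero.ne N)
  have hBA : B * A = ω⁻¹ • (A * B) := by rw [hAB, smul_smul, inv_mul_cancel₀ hω0, one_smul]
  exact exists_pow_card_eq_smul_one hB hA hω.inv hBA

omit [NeZero N] in
/-- Index arithmetic: for `a, a₀ < N`, `N ∣ N − a₀ + a` iff `a = a₀`. [folklore] -/
private theorem dvd_sub_add_iff {a a₀ : ℕ} (ha : a < N) (ha₀ : a₀ < N) : N ∣ N - a₀ + a ↔ a = a₀ := by
  constructor
  · rintro ⟨c, hc⟩
    have hc0 : c ≠ 0 := by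
      rintro rfl
      omega
    have hc2 : c < 2 := by
      by_contra h
      have : N * 2 ≤ N * c := Nat.mul_le_mul_left N (by omega)
      omega
    have hc1 : c = 1 := by omega
    subst hc1
    omega
  · rintro rfl
    exact ⟨1, by omega⟩

/-- **Theorem 1 of the source ('t Hooft's matrix basis): for a Weyl pair with a primitive phase the `N²` products
`A^a B^b`, `0 ≤ a, b < N`, are linearly independent.**  Proof as printed («very similar to the corresponding one for
the Clifford algebra»): pair `Σ c_{ab} A^a B^b = 0` against `B^{N−b₀} A^{N−a₀}` under the trace; by Lemma 1 only the
term `(a₀, b₀)` survives, with `tr(A^N B^N) = N α β ≠ 0`. [cite: Gonzalezarroyo1998, §4.3 Thm 1] -/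
theorem linearIndependent_pow_mul_pow (hA : IsUnit A) (hB : IsUnit B) (hω : IsPrimitiveRoot ω N)
    (hAB : A * B = ω • (B * A)) :
    LinearIndependent ℂ (fun p : Fin N × Fin N => A ^ (p.1 : ℕ) * B ^ (p.2 : ℕ)) := by
  classical
  obtain ⟨α, hα0, hα⟩ := exists_pow_card_eq_smul_one hA hB hω hAB
  obtain ⟨β, hβ0, hβ⟩ := exists_pow_card_eq_smul_one' hA hB hω hAB
  rw [Fintype.linearIndependent_iff]
  intro g hg p₀
  obtain ⟨a₀, b₀⟩ := p₀
  -- pair against `B^{N-b₀} A^{N-a₀}` under the trace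
  have key : ∀ p : Fin N × Fin N,
      (A ^ (p.1 : ℕ) * B ^ (p.2 : ℕ) * (B ^ (N - b₀) * A ^ (N - a₀))).trace =
        if p = (a₀, b₀) then (N : ℂ) * α * β else 0 := by
    rintro ⟨a, b⟩
    have hcyc : (A ^ (a : ℕ) * B ^ (b : ℕ) * (B ^ (N - b₀) * A ^ (N - a₀))).trace =
        (A ^ (N - a₀ + a) * B ^ (b + (N - b₀))).trace := by
      rw [← mul_assoc, Matrix.trace_mul_comm, pow_add, pow_add]
      simp only [mul_assoc]
    rw [hcyc]
    by_cases hab : (a, b) = (a₀, b₀)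
    · obtain ⟨rfl, rfl⟩ := Prod.mk.inj hab
      rw [if_pos rfl, Nat.sub_add_cancel a.2.le, add_comm, Nat.sub_add_cancel b.2.le, hα, hβ, Matrix.smul_mul,
        Matrix.one_mul, smul_smul, Matrix.trace_smul, Matrix.trace_one, Fintype.card_fin, smul_eq_mul]
      ring
    · rw [if_neg hab]
      by_cases ha : a = a₀
      · subst ha
        have hb : b ≠ b₀ := fun h => hab (by rw [h])
        have hnd : ¬ N ∣ b + (N - b₀) := by
          rw [add_comm, dvd_sub_add_iff b.2 b₀.2]; exact fun h => hb (Fin.ext h)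
        exact trace_pow_mul_pow_eq_zero_of_not_dvd hA hω hAB hnd
      · have hnd : ¬ N ∣ N - a₀ + a := by
          rw [dvd_sub_add_iff a.2 a₀.2]; exact fun h => ha (Fin.ext h)
        exact trace_pow_mul_pow_eq_zero_of_not_dvd' hB hω hAB hnd
  have h := congrArg (fun X : Matrix (Fin N) (Fin N) ℂ => (X * (B ^ (N - b₀) * A ^ (N - a₀))).trace) hg
  simp only [Finset.sum_mul, smul_mul_assoc, Matrix.trace_sum, Matrix.trace_smul, smul_eq_mul, key, mul_ite,
    mul_zero, Finset.sum_ite_eq', Finset.mem_univ, if_true, Matrix.zero_mul, Matrix.trace_zero] at h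
  have hN : (N : ℂ) ≠ 0 := Nat.cast_ne_zero.2 (NeZero.ne N)
  have hprod : (N : ℂ) * α * β ≠ 0 := mul_ne_zero (mul_ne_zero hN hα0) hβ0
  exact (mul_eq_zero.1 h).resolve_right hprod

/-- **… and they span the `N × N` matrices** (`N²` independent vectors in dimension `N²`): every complex matrix is a
combination of the `A^a B^b` — the twist-eater algebra as a basis of `gl(N, ℂ)` (and, dropping `(0,0)`, of `sl(N, ℂ)`).
[cite: Gonzalezarroyo1998, §4.3 Thm 1] -/
theorem span_pow_mul_pow_eq_top (hA : IsUnit A) (hB : IsUnit B) (hω : IsPrimitiveRoot ω N)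
    (hAB : A * B = ω • (B * A)) :
    Submodule.span ℂ (Set.range fun p : Fin N × Fin N => A ^ (p.1 : ℕ) * B ^ (p.2 : ℕ)) = ⊤ :=
  (linearIndependent_pow_mul_pow hA hB hω hAB).span_eq_top_of_card_eq_finrank' (by
    rw [Fintype.card_prod, Fintype.card_fin, Module.finrank_matrix, Fintype.card_fin, Module.finrank_self, mul_one])

end Basis

/-! ## §6 Colour momentum (García Pérez–González-Arroyo–Okawa 2014 §2–§3; González-Arroyo 1998 §4.3): the adjoint action of
a unitary Weyl pair on the 't Hooft basis, Hilbert–Schmidt orthogonality, roots of unity versus `4 sin²(π/N)`, and the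
twisted (TEK-type) adjoint Laplacian gap on traceless matrices -/

section ColourMomentum

variable [NeZero N] {A B : Matrix (Fin N) (Fin N) ℂ} {ω : ℂ}

omit [NeZero N] in
/-- **Colour momentum of `A^a B^b` under `Ad A`**: `A (A^a B^b) = ω^b (A^a B^b) A`. [cite: Gonzalezarroyo1998, §4.3] -/
theorem mul_pow_mul_pow_eq_smul (hAB : A * B = ω • (B * A)) (a b : ℕ) :
    A * (A ^ a * B ^ b) = ω ^ b • (A ^ a * B ^ b * A) := by
  rw [← mul_assoc, ← pow_succ', pow_succ, mul_assoc, TwistEaterUniqueness.mul_pow_eq_smul hAB b,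
    mul_smul_comm, ← mul_assoc]

omit [NeZero N] in
/-- **Colour momentum of `A^a B^b` under `Ad B`**: `(A^a B^b) B = ω^a B (A^a B^b)`. [cite: Gonzalezarroyo1998, §4.3] -/
theorem pow_mul_pow_mul_eq_smul (hAB : A * B = ω • (B * A)) (a b : ℕ) :
    A ^ a * B ^ b * B = ω ^ a • (B * (A ^ a * B ^ b)) := by
  rw [mul_assoc, ← pow_succ, pow_succ', ← mul_assoc, TwistEaterUniqueness.pow_mul_eq_smul hAB a,
    smul_mul_assoc, mul_assoc]

omit [NeZero N] in
/-- Unitary form: `A (A^a B^b) Aᴴ = ω^b · A^a B^b` (the basis matrices are joint eigenvectors of the adjoint action of the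
pair — «colour momentum»). [cite: GarciaperezGonzalezarroyoOkawa2014, §2] -/
theorem mul_pow_mul_pow_mul_conjTranspose (hAB : A * B = ω • (B * A)) (hA : A * Aᴴ = 1) (a b : ℕ) :
    A * (A ^ a * B ^ b) * Aᴴ = ω ^ b • (A ^ a * B ^ b) := by
  rw [mul_pow_mul_pow_eq_smul hAB, smul_mul_assoc, mul_assoc, hA, mul_one]

omit [NeZero N] in
/-- Unitary form for `B`: `B (A^a B^b) Bᴴ = ω^{−a} · A^a B^b`. [cite: GarciaperezGonzalezarroyoOkawa2014, §2] -/
theorem conj_pow_mul_pow_eq_smul (hAB : A * B = ω • (B * A)) (hB : B * Bᴴ = 1) (hωa : ∀ a : ℕ, ω ^ a ≠ 0)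
    (a b : ℕ) : B * (A ^ a * B ^ b) * Bᴴ = (ω ^ a)⁻¹ • (A ^ a * B ^ b) := by
  have h : B * (A ^ a * B ^ b) = (ω ^ a)⁻¹ • (A ^ a * B ^ b * B) := by
    rw [pow_mul_pow_mul_eq_smul hAB, smul_smul, inv_mul_cancel₀ (hωa a), one_smul]
  rw [h, smul_mul_assoc, mul_assoc, hB, mul_one]

omit [NeZero N] in
/-- For a unitary `A` with `A^N = α·1`: `(Aᴴ)^a = α⁻¹ · A^{N−a}` (`a ≤ N`). [folklore] -/
private theorem conjTranspose_pow_eq_smul_pow (hA : Aᴴ * A = 1) (hA' : A * Aᴴ = 1) {α : ℂ} (hα0 : α ≠ 0)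
    (hα : A ^ N = α • (1 : Matrix (Fin N) (Fin N) ℂ)) {a : ℕ} (ha : a ≤ N) :
    (Aᴴ) ^ a = α⁻¹ • A ^ (N - a) := by
  have hcomm : Commute Aᴴ A := by rw [Commute, SemiconjBy, hA, hA']
  have h1 : Aᴴ ^ a * A ^ a = 1 := by rw [← hcomm.mul_pow, hA, one_pow]
  have h2 : Aᴴ ^ a * A ^ N = A ^ (N - a) := by
    have hN' : a + (N - a) = N := Nat.add_sub_cancel' ha
    calc Aᴴ ^ a * A ^ N = Aᴴ ^ a * A ^ (a + (N - a)) := by rw [hN']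
      _ = A ^ (N - a) := by rw [pow_add, ← mul_assoc, h1, one_mul]
  rw [hα, Matrix.mul_smul, Matrix.mul_one] at h2
  rw [← h2, smul_smul, inv_mul_cancel₀ hα0, one_smul]

/-- **The trace pairing of the 't Hooft basis**: `tr(A^a B^b · B^{N−b₀} A^{N−a₀}) = N α β · [(a,b) = (a₀,b₀)]` for
`A^N = α·1`, `B^N = β·1` (Lemma 1 kills every other term). [cite: Gonzalezarroyo1998, §4.3 Thm 1] -/
theorem trace_pow_mul_pow_mul_pow_mul_pow (hA : IsUnit A) (hB : IsUnit B) (hω : IsPrimitiveRoot ω N)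
    (hAB : A * B = ω • (B * A)) {α β : ℂ} (hα : A ^ N = α • (1 : Matrix (Fin N) (Fin N) ℂ))
    (hβ : B ^ N = β • (1 : Matrix (Fin N) (Fin N) ℂ)) (a b a₀ b₀ : Fin N) :
    (A ^ (a : ℕ) * B ^ (b : ℕ) * (B ^ (N - b₀) * A ^ (N - a₀))).trace =
      if (a, b) = (a₀, b₀) then (N : ℂ) * α * β else 0 := by
  classical
  have hcyc : (A ^ (a : ℕ) * B ^ (b : ℕ) * (B ^ (N - b₀) * A ^ (N - a₀))).trace =
      (A ^ (N - a₀ + a) * B ^ (b + (N - b₀))).trace := by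
    rw [← mul_assoc, Matrix.trace_mul_comm, pow_add, pow_add]
    simp only [mul_assoc]
  rw [hcyc]
  by_cases hab : (a, b) = (a₀, b₀)
  · obtain ⟨rfl, rfl⟩ := Prod.mk.inj hab
    rw [if_pos rfl, Nat.sub_add_cancel a.2.le, add_comm, Nat.sub_add_cancel b.2.le, hα, hβ, Matrix.smul_mul,
      Matrix.one_mul, smul_smul, Matrix.trace_smul, Matrix.trace_one, Fintype.card_fin, smul_eq_mul]
    ring
  · rw [if_neg hab]
    by_cases ha : a = a₀
    · subst ha
      have hb : b ≠ b₀ := fun h => hab (by rw [h])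
      have hnd : ¬ N ∣ b + (N - b₀) := by
        rw [add_comm, dvd_sub_add_iff b.2 b₀.2]; exact fun h => hb (Fin.ext h)
      exact trace_pow_mul_pow_eq_zero_of_not_dvd hA hω hAB hnd
    · have hnd : ¬ N ∣ N - a₀ + a := by
        rw [dvd_sub_add_iff a.2 a₀.2]; exact fun h => ha (Fin.ext h)
      exact trace_pow_mul_pow_eq_zero_of_not_dvd' hB hω hAB hnd

/-- ★ **Hilbert–Schmidt orthogonality of the 't Hooft basis** for a UNITARY Weyl pair:
`tr((A^a B^b)ᴴ (A^{a'} B^{b'})) = N · [(a,b) = (a',b')]`. [cite: GarciaperezGonzalezarroyoOkawa2014, §2]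
[cite: Gonzalezarroyo1998, §4.3 Thm 1] -/
theorem trace_conjTranspose_pow_mul_pow_mul (hAu : A ∈ Matrix.unitaryGroup (Fin N) ℂ)
    (hBu : B ∈ Matrix.unitaryGroup (Fin N) ℂ) (hω : IsPrimitiveRoot ω N) (hAB : A * B = ω • (B * A))
    (a b a' b' : Fin N) :
    ((A ^ (a : ℕ) * B ^ (b : ℕ))ᴴ * (A ^ (a' : ℕ) * B ^ (b' : ℕ))).trace = if (a, b) = (a', b') then (N : ℂ) else 0 := by
  classical
  have hA : IsUnit A := ⟨⟨A, star A, hAu.2, hAu.1⟩, rfl⟩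
  have hB : IsUnit B := ⟨⟨B, star B, hBu.2, hBu.1⟩, rfl⟩
  obtain ⟨α, hα0, hα⟩ := exists_pow_card_eq_smul_one hA hB hω hAB
  obtain ⟨β, hβ0, hβ⟩ := exists_pow_card_eq_smul_one' hA hB hω hAB
  have hAc : (Aᴴ) ^ (a : ℕ) = α⁻¹ • A ^ (N - a) := conjTranspose_pow_eq_smul_pow hAu.1 hAu.2 hα0 hα a.2.le
  have hBc : (Bᴴ) ^ (b : ℕ) = β⁻¹ • B ^ (N - b) := conjTranspose_pow_eq_smul_pow hBu.1 hBu.2 hβ0 hβ b.2.le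
  rw [Matrix.conjTranspose_mul, Matrix.conjTranspose_pow, Matrix.conjTranspose_pow, hAc, hBc, Matrix.smul_mul,
    Matrix.mul_smul, Matrix.smul_mul, Matrix.smul_mul, smul_smul, Matrix.trace_smul, smul_eq_mul]
  -- `tr(B^{N-b} A^{N-a} (A^{a'} B^{b'})) = tr(A^{a'} B^{b'} (B^{N-b} A^{N-a}))`
  rw [← Matrix.trace_mul_comm, trace_pow_mul_pow_mul_pow_mul_pow hA hB hω hAB hα hβ a' b' a b]
  by_cases h : (a, b) = (a', b')
  · rw [if_pos h, if_pos h.symm]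
    field_simp
  · rw [if_neg h, if_neg (Ne.symm h), mul_zero]

/-! ### Roots of unity versus `4 sin²(π/N)` -/

omit [NeZero N] in
/-- For `|ζ| = 1`: `‖1 − ζ‖² = 2 − 2 Re ζ`. [folklore] -/
private theorem norm_one_sub_sq_of_norm_eq_one {ζ : ℂ} (hζ : ‖ζ‖ = 1) : ‖1 - ζ‖ ^ 2 = 2 - 2 * ζ.re := by
  have h1 : ζ.re * ζ.re + ζ.im * ζ.im = 1 := by
    rw [← Complex.normSq_apply, Complex.normSq_eq_norm_sq, hζ, one_pow]
  rw [Complex.sq_norm, Complex.normSq_apply, Complex.sub_re, Complex.sub_im, Complex.one_re, Complex.one_im]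
  nlinarith [h1]

/-- **An `N`-th root of unity other than `1` has real part at most `cos(2π/N)`** (the smallest non-zero twisted momentum is
`2π/N`). [cite: GarciaperezGonzalezarroyoOkawa2014, §3] -/
theorem re_le_cos_of_pow_eq_one {ζ : ℂ} (hζN : ζ ^ N = 1) (hζ1 : ζ ≠ 1) :
    ζ.re ≤ Real.cos (2 * Real.pi / N) := by
  have hN0 : N ≠ 0 := NeZero.ne N
  have hNpos : (0 : ℝ) < N := Nat.cast_pos.2 (Nat.pos_of_ne_zero hN0)
  have hprim : IsPrimitiveRoot (Complex.exp (2 * Real.pi * Complex.I / N)) N := Complex.isPrimitiveRoot_exp N hN0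
  obtain ⟨r, hrN, hr⟩ := hprim.eq_pow_of_pow_eq_one hζN
  have hr0 : r ≠ 0 := by
    rintro rfl
    exact hζ1 (by rw [← hr, pow_zero])
  -- `ζ = exp((2πr/N) I)`, so `Re ζ = cos(2πr/N)`
  have hre : ζ.re = Real.cos (2 * Real.pi * r / N) := by
    rw [← hr, ← Complex.exp_nat_mul, show (r : ℂ) * (2 * Real.pi * Complex.I / N) =
      ((2 * Real.pi * r / N : ℝ) : ℂ) * Complex.I by push_cast; ring, Complex.exp_ofReal_mul_I_re]
  rw [hre]
  -- symmetrise: `s = min(r, N - r)` has the same cosine and `2π/N ≤ 2πs/N ≤ π`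
  have hcos_symm : Real.cos (2 * Real.pi * r / N) = Real.cos (2 * Real.pi * (N - r : ℕ) / N) := by
    rw [Nat.cast_sub hrN.le, show 2 * Real.pi * ((N : ℝ) - r) / N = 2 * Real.pi - 2 * Real.pi * r / N by
      field_simp, Real.cos_two_pi_sub]
  by_cases hr2 : 2 * r ≤ N
  · apply Real.cos_le_cos_of_nonneg_of_le_pi (by positivity)
    · rw [div_le_iff₀ hNpos]
      have : (2 : ℝ) * r ≤ N := by exact_mod_cast hr2
      nlinarith [Real.pi_pos]
    · have : (1 : ℝ) ≤ r := by exact_mod_cast Nat.one_le_iff_ne_zero.2 hr0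
      exact div_le_div_of_nonneg_right (by nlinarith [Real.pi_pos]) hNpos.le
  · rw [hcos_symm]
    have hs1 : 1 ≤ N - r := by omega
    have hs2 : 2 * (N - r) ≤ N := by omega
    apply Real.cos_le_cos_of_nonneg_of_le_pi (by positivity)
    · rw [div_le_iff₀ hNpos]
      have : (2 : ℝ) * ((N - r : ℕ) : ℝ) ≤ N := by exact_mod_cast hs2
      nlinarith [Real.pi_pos]
    · have : (1 : ℝ) ≤ ((N - r : ℕ) : ℝ) := by exact_mod_cast hs1
      exact div_le_div_of_nonneg_right (by nlinarith [Real.pi_pos]) hNpos.le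

/-- **`4 sin²(π/N) ≤ ‖1 − ζ‖²` for every `N`-th root of unity `ζ ≠ 1`** (with equality at `ζ = e^{±2πi/N}`): the
colour-momentum gap. [cite: GarciaperezGonzalezarroyoOkawa2014, §3] -/
theorem four_mul_sin_sq_le_norm_one_sub_sq {ζ : ℂ} (hζN : ζ ^ N = 1) (hζ1 : ζ ≠ 1) :
    4 * Real.sin (Real.pi / N) ^ 2 ≤ ‖1 - ζ‖ ^ 2 := by
  have hζ : ‖ζ‖ = 1 := Complex.norm_eq_one_of_pow_eq_one hζN (NeZero.ne N)
  rw [norm_one_sub_sq_of_norm_eq_one hζ, Real.sin_sq_eq_half_sub,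
    show 2 * (Real.pi / N) = 2 * Real.pi / N by ring]
  linarith [re_le_cos_of_pow_eq_one hζN hζ1]

/-- **`pair_gap`**: for a primitive `N`-th root `ω` and `(a, b) ≠ (0, 0)` in `(ℤ/N)²` (read in `Fin N × Fin N`),
`4 sin²(π/N) ≤ ‖1 − ω^a‖² + ‖1 − ω^b‖²` — every non-trivial colour momentum costs at least `4 sin²(π/N)`.
[cite: GarciaperezGonzalezarroyoOkawa2014, §3] -/
theorem four_mul_sin_sq_le_pair (hω : IsPrimitiveRoot ω N) {a b : Fin N} (hab : (a, b) ≠ (0, 0)) :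
    4 * Real.sin (Real.pi / N) ^ 2 ≤ ‖1 - ω ^ (a : ℕ)‖ ^ 2 + ‖1 - ω ^ (b : ℕ)‖ ^ 2 := by
  have hpow : ∀ c : Fin N, (ω ^ (c : ℕ)) ^ N = 1 := fun c => by
    rw [← pow_mul, mul_comm, pow_mul, hω.pow_eq_one, one_pow]
  have hne : ∀ c : Fin N, c ≠ 0 → ω ^ (c : ℕ) ≠ 1 := fun c hc =>
    hω.pow_ne_one_of_pos_of_lt (fun h0 => hc (Fin.ext h0)) c.2
  by_cases ha : a = 0
  · subst ha
    have hb : b ≠ 0 := fun h => hab (by rw [h])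
    have h := four_mul_sin_sq_le_norm_one_sub_sq (hpow b) (hne b hb)
    nlinarith [sq_nonneg ‖1 - ω ^ ((0 : Fin N) : ℕ)‖]
  · have h := four_mul_sin_sq_le_norm_one_sub_sq (hpow a) (hne a ha)
    nlinarith [sq_nonneg ‖1 - ω ^ (b : ℕ)‖]

omit [NeZero N] in
/-- `16/N² ≤ 4 sin²(π/N)` for `N ≥ 2` (Jordan's inequality `sin x ≥ 2x/π` on `[0, π/2]`): the explicit floor of the
smallest twisted lattice momentum squared `4 sin²(π/N) = |1 − e^{2πi/N}|²`. [cite: GarciaperezGonzalezarroyoOkawa2014, §3] -/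
theorem sixteen_div_sq_le_four_mul_sin_sq (hN : 2 ≤ N) : 16 / (N : ℝ) ^ 2 ≤ 4 * Real.sin (Real.pi / N) ^ 2 := by
  have hNpos : (0 : ℝ) < N := by exact_mod_cast (show 0 < N by omega)
  have hN2 : (2 : ℝ) ≤ N := by exact_mod_cast hN
  have hx0 : 0 ≤ Real.pi / N := by positivity
  have hx1 : Real.pi / N ≤ Real.pi / 2 := div_le_div_of_nonneg_left Real.pi_pos.le (by norm_num) hN2
  -- Jordan's inequality `2/π · x ≤ sin x` on `[0, π/2]`
  have hj : 2 / Real.pi * (Real.pi / N) ≤ Real.sin (Real.pi / N) := Real.mul_le_sin hx0 hx1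
  have hj' : 2 / (N : ℝ) ≤ Real.sin (Real.pi / N) := by
    have : 2 / Real.pi * (Real.pi / N) = 2 / N := by field_simp
    rwa [this] at hj
  have h2N : 0 ≤ 2 / (N : ℝ) := by positivity
  calc 16 / (N : ℝ) ^ 2 = 4 * (2 / N) ^ 2 := by field_simp; ring
    _ ≤ 4 * Real.sin (Real.pi / N) ^ 2 := by
        gcongr

/-! ### The twisted adjoint Laplacian of the pair has gap `4 sin²(π/N)` on traceless matrices -/

/-- Hilbert–Schmidt norm of an expansion in the 't Hooft basis: `tr((Σ d_p e_p)ᴴ (Σ d_p e_p)) = N Σ |d_p|²`.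
[cite: GarciaperezGonzalezarroyoOkawa2014, §2] -/
theorem trace_conjTranspose_sum_smul_pow_mul_pow (hAu : A ∈ Matrix.unitaryGroup (Fin N) ℂ)
    (hBu : B ∈ Matrix.unitaryGroup (Fin N) ℂ) (hω : IsPrimitiveRoot ω N) (hAB : A * B = ω • (B * A))
    (d : Fin N × Fin N → ℂ) :
    ((∑ p, d p • (A ^ (p.1 : ℕ) * B ^ (p.2 : ℕ)))ᴴ * (∑ p, d p • (A ^ (p.1 : ℕ) * B ^ (p.2 : ℕ)))).trace =
      (N : ℂ) * ∑ p, (starRingEnd ℂ (d p) * d p) := by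
  classical
  rw [Matrix.conjTranspose_sum, Matrix.sum_mul, Matrix.trace_sum, Finset.mul_sum]
  refine Finset.sum_congr rfl fun p _ => ?_
  rw [Matrix.conjTranspose_smul, Matrix.smul_mul, Matrix.trace_smul, Matrix.mul_sum, Matrix.trace_sum]
  have hq : ∀ q : Fin N × Fin N,
      ((A ^ (p.1 : ℕ) * B ^ (p.2 : ℕ))ᴴ * (d q • (A ^ (q.1 : ℕ) * B ^ (q.2 : ℕ)))).trace =
        if p = q then d q * N else 0 := by
    intro q
    rw [Matrix.mul_smul, Matrix.trace_smul, smul_eq_mul,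
      trace_conjTranspose_pow_mul_pow_mul hAu hBu hω hAB p.1 p.2 q.1 q.2]
    by_cases h : p = q
    · subst h; simp
    · have h' : (p.1, p.2) ≠ (q.1, q.2) := by rwa [Prod.mk.eta, Prod.mk.eta]
      rw [if_neg h', if_neg h, mul_zero]
  simp_rw [hq]
  rw [Finset.sum_ite_eq, if_pos (Finset.mem_univ p), smul_eq_mul, Complex.star_def]
  ring

/-- Traces of the basis: `tr(A^a B^b) = N · [(a,b) = (0,0)]` («the trace of all `Γ(n)` matrices is zero, except for those
which are elements of the center group»). [cite: Gonzalezarroyo1998, §4.3] -/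
theorem trace_pow_mul_pow (hA : IsUnit A) (hB : IsUnit B) (hω : IsPrimitiveRoot ω N)
    (hAB : A * B = ω • (B * A)) (p : Fin N × Fin N) :
    (A ^ (p.1 : ℕ) * B ^ (p.2 : ℕ)).trace = if p = (0, 0) then (N : ℂ) else 0 := by
  classical
  by_cases h : p = (0, 0)
  · subst h
    simp [Matrix.trace_one]
  · rw [if_neg h]
    by_cases h1 : p.1 = 0
    · have h2 : p.2 ≠ 0 := fun h2 => h (Prod.ext h1 h2)
      have hnd : ¬ N ∣ (p.2 : ℕ) := fun hd =>
        h2 (Fin.ext (Nat.eq_zero_of_dvd_of_lt hd p.2.2))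
      exact trace_pow_mul_pow_eq_zero_of_not_dvd hA hω hAB hnd
    · have hnd : ¬ N ∣ (p.1 : ℕ) := fun hd =>
        h1 (Fin.ext (Nat.eq_zero_of_dvd_of_lt hd p.1.2))
      exact trace_pow_mul_pow_eq_zero_of_not_dvd' hB hω hAB hnd

/-- ★ **The twisted adjoint Laplacian of a generating pair has gap `4 sin²(π/N)` on traceless matrices** (no zero mode and
the explicit floor): for unitary `A, B` with `A B = ω·B A`, `ω` a primitive `N`-th root of unity, and every TRACELESS `Φ`,
`‖AΦAᴴ − Φ‖²_HS + ‖BΦBᴴ − Φ‖²_HS ≥ 4 sin²(π/N) · ‖Φ‖²_HS` (`‖X‖²_HS = tr(XᴴX)`).  Proof: expand `Φ = Σ c_{ab} A^aB^b`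
('t Hooft basis, §5); `Ad A`, `Ad B` act diagonally with eigenvalues `ω^b`, `ω^{−a}`; orthogonality turns both sides into
weighted sums of `|c_{ab}|²`; `c_{00} = tr Φ / N = 0` and `pair_gap`.  This is the one-site (TEK ∕ fibre) kernel of the
twisted-box fluctuation operator: momenta are quantised in units of `2π/N` AWAY from zero.
[cite: GarciaperezGonzalezarroyoOkawa2014, §3] [cite: Gonzalezarroyo1998, §4.3 Thm 1] -/
theorem twistedLaplacian_gap (hAu : A ∈ Matrix.unitaryGroup (Fin N) ℂ) (hBu : B ∈ Matrix.unitaryGroup (Fin N) ℂ)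
    (hω : IsPrimitiveRoot ω N) (hAB : A * B = ω • (B * A)) {Φ : Matrix (Fin N) (Fin N) ℂ} (hΦ : Φ.trace = 0) :
    4 * Real.sin (Real.pi / N) ^ 2 * ((Φᴴ * Φ).trace).re ≤
      (((A * Φ * Aᴴ - Φ)ᴴ * (A * Φ * Aᴴ - Φ)).trace).re + (((B * Φ * Bᴴ - Φ)ᴴ * (B * Φ * Bᴴ - Φ)).trace).re := by
  classical
  have hA : IsUnit A := ⟨⟨A, star A, hAu.2, hAu.1⟩, rfl⟩
  have hB : IsUnit B := ⟨⟨B, star B, hBu.2, hBu.1⟩, rfl⟩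
  have hN0 : N ≠ 0 := NeZero.ne N
  have hω0 : ∀ a : ℕ, ω ^ a ≠ 0 := fun a => pow_ne_zero _ (hω.ne_zero hN0)
  have hω1 : ∀ a : ℕ, ‖ω ^ a‖ = 1 := fun a => by rw [norm_pow, hω.norm'_eq_one hN0, one_pow]
  -- the 't Hooft basis and the coordinates of `Φ`
  set e : Fin N × Fin N → Matrix (Fin N) (Fin N) ℂ := fun p => A ^ (p.1 : ℕ) * B ^ (p.2 : ℕ) with he
  have hli : LinearIndependent ℂ e := linearIndependent_pow_mul_pow hA hB hω hAB
  haveI : Nonempty (Fin N × Fin N) := ⟨(0, 0)⟩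
  have hcard : Fintype.card (Fin N × Fin N) = Module.finrank ℂ (Matrix (Fin N) (Fin N) ℂ) := by
    rw [Fintype.card_prod, Fintype.card_fin, Module.finrank_matrix, Fintype.card_fin, Module.finrank_self, mul_one]
  let bs : Module.Basis (Fin N × Fin N) ℂ (Matrix (Fin N) (Fin N) ℂ) := basisOfLinearIndependentOfCardEqFinrank hli hcard
  have hbs : ⇑bs = e := coe_basisOfLinearIndependentOfCardEqFinrank hli hcard
  set c : Fin N × Fin N → ℂ := bs.equivFun Φ with hc
  have hΦe : Φ = ∑ p, c p • e p := by
    have h := bs.sum_equivFun Φ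
    rw [hbs] at h
    exact h.symm
  -- `c (0,0) = 0` from `tr Φ = 0`
  have hc0 : c (0, 0) = 0 := by
    have h := congrArg Matrix.trace hΦe
    rw [hΦ, Matrix.trace_sum] at h
    simp only [Matrix.trace_smul, smul_eq_mul, he, trace_pow_mul_pow hA hB hω hAB, mul_ite, mul_zero,
      Finset.sum_ite_eq', Finset.mem_univ, if_true] at h
    have hN : (N : ℂ) ≠ 0 := Nat.cast_ne_zero.2 hN0
    exact (mul_eq_zero.1 h.symm).resolve_right hN
  -- the adjoint actions in coordinates
  have hAΦ : A * Φ * Aᴴ - Φ = ∑ p, (c p * (ω ^ (p.2 : ℕ) - 1)) • e p := by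
    rw [hΦe, Matrix.mul_sum, Matrix.sum_mul, ← Finset.sum_sub_distrib]
    refine Finset.sum_congr rfl fun p _ => ?_
    rw [Matrix.mul_smul, Matrix.smul_mul, he, mul_pow_mul_pow_mul_conjTranspose hAB hAu.2, smul_smul, ← sub_smul]
    congr 1
    ring
  have hBΦ : B * Φ * Bᴴ - Φ = ∑ p, (c p * ((ω ^ (p.1 : ℕ))⁻¹ - 1)) • e p := by
    rw [hΦe, Matrix.mul_sum, Matrix.sum_mul, ← Finset.sum_sub_distrib]
    refine Finset.sum_congr rfl fun p _ => ?_
    rw [Matrix.mul_smul, Matrix.smul_mul, he, conj_pow_mul_pow_eq_smul hAB hBu.2 hω0, smul_smul, ← sub_smul]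
    congr 1
    ring
  -- Hilbert–Schmidt norms in coordinates
  have hnorm : ∀ d : Fin N × Fin N → ℂ,
      (((∑ p, d p • e p)ᴴ * (∑ p, d p • e p)).trace).re = (N : ℝ) * ∑ p, ‖d p‖ ^ 2 := by
    intro d
    rw [he, trace_conjTranspose_sum_smul_pow_mul_pow hAu hBu hω hAB d]
    simp only [Complex.mul_re, Complex.natCast_re, Complex.natCast_im, zero_mul, sub_zero, Complex.re_sum,
      Complex.conj_mul', ← Complex.ofReal_pow, Complex.ofReal_re]
  rw [hAΦ, hBΦ, hnorm, hnorm, hΦe, hnorm, ← mul_assoc, mul_comm (4 * Real.sin (Real.pi / N) ^ 2) (N : ℝ),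
    mul_assoc, ← mul_add, Finset.mul_sum, ← Finset.sum_add_distrib]
  refine mul_le_mul_of_nonneg_left (Finset.sum_le_sum fun p _ => ?_) (Nat.cast_nonneg N)
  -- termwise: `4 sin² |c_p|² ≤ |c_p|² (|ω^b - 1|² + |ω^{-a} - 1|²)`
  rw [norm_mul, norm_mul, mul_pow, mul_pow]
  have hinv : ‖(ω ^ (p.1 : ℕ))⁻¹ - 1‖ = ‖1 - ω ^ (p.1 : ℕ)‖ := by
    rw [show (ω ^ (p.1 : ℕ))⁻¹ - 1 = (ω ^ (p.1 : ℕ))⁻¹ * (1 - ω ^ (p.1 : ℕ)) by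
      rw [mul_sub, mul_one, inv_mul_cancel₀ (hω0 _)], norm_mul, norm_inv, hω1, inv_one, one_mul]
  rw [hinv, norm_sub_rev (ω ^ (p.2 : ℕ)) 1]
  by_cases hp : p = (0, 0)
  · rw [hp, hc0]; simp
  · have hp' : (p.1, p.2) ≠ ((0 : Fin N), (0 : Fin N)) := by rwa [Prod.mk.eta]
    have hgap := four_mul_sin_sq_le_pair hω hp'
    nlinarith [sq_nonneg ‖c p‖, hgap]

end ColourMomentum

end Literature.MathematicalPhysics.QuantumLattice
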